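import Summits.QuantumFields.YangMills.Theorems.BalabanUVNodesN19KeyedCoreEdgeHolderD4TrimmedK3V5
import Summits.QuantumFields.YangMills.Theorems.BalabanUVNodesK3V6Defs

/-!
# BalabanUVNodes ∕ N19 — K3 «v6» BY NAME: the N19′ face of the n19-w3 road in dag-n27-w1's mirror `…K3V6Defs` (p625739) — `KeyedCoreEdgeHolderD4BFree β cr (rrOfRecord 𝔯 ksel)` and
# the SLOT FACE `KeyedCoreEdgeHolderD4V β cr (rrOfRecord 𝔯 ksel)` BY NAME, and K3⁸ `SpineGivenEndpointR13SepCoPHV` (stmt-QuantumFields-27366) CONDITIONALLY through the mirror's door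
# `spineGivenEndpointR13SepCoPHV_of_facesBFree` — the by-name twin of the sibling `…SlotK3R8` (texts spelled there, named here)

Cell `pub-ymgap`, HUMAN RULING D-0062 (Track A), WIDTH SEAT `pub-ymgap-dag-n19-w3` (N19 NE7, seat 3 of 3), generation g4; bus INTENT-6.  Cluster item **K3⁸ «SpineGivenEndpointR13SepCoPHV»
(stmt-QuantumFields-27366)**, skeleton K3 «v6» b4e55110ab73e679 (GATE v1.70); dag-n27-w1's BY-NAME MIRROR `…K3V6Defs` (p625739, ns `…Theorems.K3V6Defs`).  Filed `--kind proof --supports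
stmt-QuantumFields-27366 --as helper` (proves no registered stub: v6's `stub_expansion13H` ∃-binds `jc sh cr` with `PinnedAtLive` and four more faces).  COUNT-NEUTRAL.  THEOREMS ONLY;
0 `def`; 0 `sorry`; `N = 2`, the item guard, reading-generic `cr`.  Imports the sibling `…TrimmedK3V5` (this seat g4, p623655: the (B)-free text PROVED) and `…K3V6Defs` — CITED BY
NAME, none edited.

WHAT THIS FILE PROVES (section hypotheses `hG16`, `hβ1`, `hβw`, `hlinkTrim`; theorem binders `hβ23`, the letter rows `hs hL h9 hWall`; for §2 the mirror's (B)-free faces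
`hr : KeyedRatesHolderD4BFree β (rrOfRecord 𝔯 ksel)` (stub 1's rates), `h20 : KeyedRelWeight cr`, `h21 : KeyedShellWeight cr`, `hx : KeyedExtractionBFree cr` — ALL HYPOTHESES):
§1 ★★★ `keyedCoreEdgeHolderD4BFree_byName_…` : `K3V6Defs.KeyedCoreEdgeHolderD4BFree β cr (rrOfRecord 𝔯 ksel)` (= p623655 ★★★, `Iff.rfl`) · ★★★ `keyedCoreEdgeHolderD4V_byName_…` :
`K3V6Defs.KeyedCoreEdgeHolderD4V β cr (rrOfRecord 𝔯 ksel)` — v6 stub 2's N19′ CONJUNCT BY NAME at every slot (`keyedCoreEdgeHolderD4V_of_bFree`).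
§2 ★★ `spineGivenEndpointR13SepCoPHV_of_guardedReadingN16_facesBFree_letters_trimmedLinkReading` : **K3⁸ BY NAME, CONDITIONALLY** — the mirror's door
`spineGivenEndpointR13SepCoPHV_of_facesBFree β cr (rrOfRecord 𝔯 ksel) h20 h21 hr §1 hx`: THE N19′-SIDE BILL OF K3⁸ IN THE MIRROR's NAMES (`GuardedReadingN16`, `2∕3 < β ≤ 1`, `hβw`,
`hs hL h9 hWall`, `hlinkTrim` (0∕1 inhabited), `KeyedRatesHolderD4BFree`, `KeyedRelWeight`, `KeyedShellWeight`, `KeyedExtractionBFree`).  `proof.conditional`, credits nothing.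

HONEST FRAMING.  Count-neutral kernel bookkeeping; every antecedent is a HYPOTHESIS; §2 is a CONDITIONAL reading of the crux's statement, NOT a proof of it — K3⁸ stmt-QuantumFields-27366
stays OPEN and UNCLAIMED, no stub of v6 is proved, the skeleton is untouched; nothing of Bałaban's asserted or instantiated (K0⁷ OPEN; the slot proves no estimate); NE7 NOT PRINTED ∕ NOT
proved; N14 ∕ N16 ∕ N19 ∕ N22 NOT discharged; A6: at THE END's letter recipe of record the kept radii rows of `hlinkTrim` are unsatisfiable (dag-n21-w6 p614571; dag-n16-e's CLAIM-50
producer road pending) — plan's (t-N16b) word; counts unmoved (typed 28∕28 · discharged 5∕27 · A 5∕28).  One finite four-torus at fixed ε — R4 closes the CONDITIONAL finite-𝕋⁴ rung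
`BalabanLadder.UV` only; NOT infinite volume ∕ OS ∕ mass gap; the YM mass gap (Clay) is NOT proved by any of this.  Standard axioms.  Edits nothing.
-/

set_option autoImplicit false

noncomputable section

open Finset MeasureTheory
open scoped BigOperators Matrix Matrix.Norms.L2Operator

namespace Summit.QuantumFields.YangMills.BalabanUVNodes.N19KeyedCoreEdgeHolderD4K3V6


open Literature.MathematicalPhysics.QuantumFieldTheory.Balaban1983to89
open T4OutputRate T4RecentScale T4GoodClassBudget T4CauchySum T4TowerRateComposition T4TowerRateDischarge
open T4EtaRateMin (Readings NE3Shape)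
open T4RateLiaison (GaugeDominated)
open FlowStep (RGEqH prefixOf)
open TreeLengthTorus (TFaceConnected torusTreeLen)
open B12TreeDecay (kappa₀)
open Summit.QuantumFields.BalabanUV.T4Continuum
open AveragingDeficitDualResidual (dualC1 dualC2)
open AveragingDeficitDerivWallProof (wallConst)
open AveragingDeficitPeriodicCounting (IsPeriodicDir)
open MinimalActionSandwich (IsMinimiser minAct)
open MinimalActionRate (sfClass)
open MinimalActionRefine (RegularSup gradConst)
open NE3EnergyShapes (IsUnitarySite IsPeriodicSite)
open NE3.LeafIndexSockets (LeafH3sup)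
open Summit.QuantumFields.BalabanUV.T4Continuum.Spine
open Summit.QuantumFields.BalabanUV.T4Continuum.Spine.NE4 (runFlow)
open Summit.QuantumFields.BalabanUV.T4Continuum.NE1p.DressedRoot (DressedTower DressedStabilityStrict)
open Summit.QuantumFields.YangMills.BalabanUVNodes.N19LedgerLinkSync (LedgerDataSync LedgerAtSync)
open YMDAG.UVSplit (SpineCarriers SpineRecordPred InputsPred U3Carriers RateCarriers RateRecordPred N14At N18At N22At ReadOutAt)
open Summit.QuantumFields.YangMills.BalabanUVNodes.N16HolderDefs (CovRootHolder N16HolderAt)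
open Summit.QuantumFields.YangMills.BalabanUVNodes.SpineRatesHolder (RatesHolderAt)
open Literature.MathematicalPhysics.QuantumFieldTheory.Balaban1983to89.T4Continuum (T4Family ULoop)
open YMDAG.UVSplit (Datum RateReading₁₃CoPH rateCarriersOfRecord₁₃CoPH ne3OfRecord₁₁)
open Node00 (Stage13HParams datumOfRecord₁₃CoPH SiteSeqKey NE3Letters₁₁ ne3ConstLayerOfRecord₁₁ ne3NperOfRecord₁₁ ne3DomOfRecord₁₁)
open Summit.QuantumFields.YangMills.BalabanUVNodes.N16PinnedLayer13CoPH (N16PinnedLoose N16LettersEnd)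
open YMDAG.N14.TopBorn (ne1OfRecord obsSupNorm)
open Node00 (U3Letters₁₁)
open Literature.MathematicalPhysics.QuantumFieldTheory.Balaban1983to89.Node00.U3OfKernels (objectsOfRecord₁₃)
open T4WeightBudget (RelWeightBound)
open T4IndicatorShell (ShellWeightBound)
open T4ContinuumYM4Torus (ForSmallCouplings)
open T4ApexHybrid (HybridNE7Under)
open Summit.QuantumFields.YangMills.Theorems.K3V5Defs (SpineReading RunSel LetterReading rrOfRecord PHolderD4 KeyedRatesHolderD4 GuardedReadingN16 KeyedRelWeight KeyedShellWeight
  KeyedCoreEdgeHolderD4 KeyedExtraction)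
open Literature.MathematicalPhysics.QuantumFieldTheory.Balaban1983to89.Node00.U3KernelLetters (PolLimitsExistOfRecord₁₃ WindowedNE9OfRecord₁₃ WindowedDecayOfRecord₁₃)
open Summit.QuantumFields.YangMills.BalabanUVNodes.N19KeyedCoreEdgeHolderD4LettersK3V5 (keyedCoreEdgeHolderD4_rrOfRecord_of_guardedReadingN16_letters_ledgerLinkReading
  hybridNE7Under_of_guardedReadingN16_keyedFaces_letters_ledgerLinkReading)
open Summit.QuantumFields.YangMills.BalabanUVNodes.N19RateEdgeHolderD4AtTrimmedLedgerReading (linkReadingAtLedgerReading_of_linkReadingAtTrimmedLedgerReading)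
open Summit.QuantumFields.YangMills.BalabanUVNodes.N19UniformLettersAtU3Pin (hunif_of_u3Pinned_of_signs)
open Summit.QuantumFields.YangMills.BalabanUVNodes.N19BundleDecayLetterFromStub1Rows (hdecT_of_u3Pinned_of_stub1Rows)
open Summit.QuantumFields.YangMills.BalabanUVNodes.N19RateEdgeHolderD4AtN16PinnedReadingFSC (forSmallCouplings_h19HolderD4_datumOfRecord₁₃CoPH_of_linkReadingAtN16PinnedReading)
open Summit.QuantumFields.YangMills.BalabanUVNodes.N19RateEdgeHolderD4AtPinnedReading (linkReadingAtN16PinnedReading_of_linkReadingAtPinnedReading)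
open Summit.QuantumFields.YangMills.BalabanUVNodes.N19RateEdgeHolderD4AtKeyedReading (linkReadingAtPinnedReading_of_linkReadingAtKeyedReading)
open Summit.QuantumFields.YangMills.BalabanUVNodes.N19RateEdgeHolderD4AtLedgerReading (linkReadingAtKeyedReading_of_linkReadingAtLedgerReading)

open Summit.QuantumFields.YangMills.Theorems.K3V6Defs (KeyedRatesHolderD4BFree KeyedCoreEdgeHolderD4V KeyedCoreEdgeHolderD4BFree KeyedExtractionBFree keyedCoreEdgeHolderD4V_of_bFree
  spineGivenEndpointR13SepCoPHV_of_facesBFree)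
open Summit.QuantumFields.YangMills.BalabanUVNodes.N19KeyedCoreEdgeHolderD4TrimmedK3V5 (keyedCoreEdgeHolderD4BFree_rrOfRecord_of_guardedReadingN16_letters_trimmedLinkReading)

section ByNameV6

variable (cr : SpineReading) (𝔯 : RateReading₁₃CoPH 2) (ksel : RunSel) (ℓ : LetterReading) (ℓ₃ : T4Family → NE3Letters₁₁) (g B : T4Family → ℝ) {β : ℝ} (hβ1 : β ≤ 1)
  (hG16 : GuardedReadingN16 𝔯 ksel ℓ ℓ₃ g B)
    (hβw : ∀ (F : T4Family) (θ : Stage13HParams F 2) (hP : θ.Provisos₁₃CoPH F 2), (θ.ZhUnity F 2 ∧ θ.SlotsNondegenerate₁₃ F 2) → θ.Admissible F 2 →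
      ∃ γ₀ b b' : ℝ, 0 < γ₀ ∧ 0 < b ∧ DagBinding.BetaBoundsInInterval (datumOfRecord₁₃CoPH F 2 θ hP).C.toB12 γ₀ b b')
  (hlinkTrim : ∀ (F : T4Family) (θ : Stage13HParams F 2) (hP : θ.Provisos₁₃CoPH F 2), (θ.ZhUnity F 2 ∧ θ.SlotsNondegenerate₁₃ F 2) → θ.Admissible F 2 →
    ∀ (γ gIR b : ℝ) (g₀ : ℕ → ℝ), (datumOfRecord₁₃CoPH F 2 θ hP).Tuned γ gIR g₀ → γ ≤ θ.γ → γ ^ 2 ≤ Real.exp (-1) → 0 < b →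
    (∀ K m, 0 ≤ m → m < K → b ≤ (datumOfRecord₁₃CoPH F 2 θ hP).βfun m (prefixOf (runFlow (datumOfRecord₁₃CoPH F 2 θ hP) g₀ K) m)) →
    ∀ (os : List (ULoop F)) (k : ℕ),
      let S : SpineCarriers := cr F θ hP g₀ os
      let R : RateCarriers 2 := rateCarriersOfRecord₁₃CoPH 𝔯 F θ hP g₀ os k
      let D : Datum F 2 := datumOfRecord₁₃CoPH F 2 θ hP
      letI := S.dec
      ∃ (_ : DecidableEq R.u3.C.Dom) (F' : Type) (ι' X' : Type) (_ : MeasurableSpace ι')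
        (L : LedgerDataSync R.u3.C F' ι' S.ι) (Rd : Readings ι' X') (bsel : (ℕ → ℝ) → ℝ) (EB : Functional R.u3.C R.u3.C.BgB)
        (g : ℕ → ℕ → ℝ)
        (uA : ℕ → ι' → R.u3.C.BgA) (uB : ℕ → ι' → R.u3.C.BgB)
        (Pf : ℕ → Params) (d₀ L₀ Koff : ℕ) (cells : (K j : ℕ) → R.u3.C.Dom → Finset (Site (Pf K) j))
        (H033 : Flow → ℕ → Prop) (I : Type) (fam : I → B14.Sect2Data) (Lb βw : ℝ) (κ₁ : ℕ) (Gv Cl : ℝ) (K₁ : ℕ)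
        (c' t θ : ℝ)
        (sel : ℕ → (B7Prop1Explicit.Site 4 → Fin 4 → (Matrix (Fin 2) (Fin 2) ℂ)ˣ) → (B7Prop1Explicit.Site 4 → Fin 4 → (Matrix (Fin 2) (Fin 2) ℂ)ˣ))
        (rd : ι' → (B7Prop1Explicit.Site 4 → Fin 4 → (Matrix (Fin 2) (Fin 2) ℂ)ˣ)),
        (∀ K i, i ≤ K → g K i = runFlow D g₀ K i) ∧ (∀ K i, K < i → g K i = gIR) ∧
        EB = (fun s => R.u3.EB (bsel s) s) ∧
        (∀ (Sz : ℕ → ℝ → S.ι → ℕ → ℝ) (E₀ : ℝ) (m : ℕ) (a : ℝ) (Cw Λg : ℝ),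
          (∀ K t, |t| ≤ S.l₀ → ∀ τ ∈ S.T K \ S.Bad K t, ∀ v ∈ Rd.dom, ∀ j ≤ K,
            |∑ X ∈ L.fac K t τ with R.u3.C.scale X = j,
                (Real.log (Real.exp (EB (fun i => g (K + 1) (i + 1)) (uB K v) X
                    - EB (fun i => g (K + 1) (i + 1)) L.oneB X))
                  - Real.log (Real.exp (R.u3.EA (g K) (uA K v) X - R.u3.EA (g K) L.oneA X)))| ≤ Sz K t τ j) →
          0 ≤ E₀ → 0 < a → a < 1 →
          (∀ K t, |t| ≤ S.l₀ → ∀ τ ∈ S.T K \ S.Bad K t, ∀ j ≤ K,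
            Sz K t τ j ≤ S.vol * (E₀ * ((K : ℝ) + 1) ^ m * a ^ (K - j))) →
          (∀ K, Multiplicity (L.All K) R.u3.C.scale (fun X => Real.exp (-(R.u3.κ * R.u3.C.d X))) Cw S.vol Λg K) →
          (∀ K t, |t| ≤ S.l₀ → ∀ τ ∈ S.T K \ S.Bad K t,
            WindowMultiplicity (L.facO K t τ) L.scO L.wO Cw S.vol Λg (jlogOf L.Cl K) K) →
          1 ≤ Λg → L.θ' ≤ Λg →
          LedgerAtSync { L with S := Sz, E₀ := E₀, m := m, a := a, Cw := Cw, Λg := Λg } S.l₀ S.vol S.T S.Bad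
            (fun K t τ => S.A K t τ - S.shA K t τ) (fun K t τ => S.B K t τ - S.shB K t τ) Rd R.u3.EA EB R.u3.κ g uA uB
            R.u3.ω R.u3.ρ R.u3.θ (θ ^ ((3 : ℝ) * β - 2))) ∧
        0 ≤ S.vol ∧
        (∀ K t, |t| ≤ S.l₀ → ∀ τ ∈ S.T K \ S.Bad K t,
          WindowMultiplicity (L.facO K t τ) L.scO L.wO L.Cw S.vol L.Λg (jlogOf L.Cl K) K) ∧
        0 ≤ L.Cw ∧ 1 ≤ L.Λg ∧ L.θ' ≤ L.Λg ∧
        (∀ K, (Pf K).d = d₀) ∧ (∀ K, (Pf K).L = L₀) ∧ (∀ K, (Pf K).K = Koff + K) ∧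
        (∀ K, (Fintype.card (Site (Pf K) (Pf K).K) : ℝ) = S.vol) ∧
        kappa₀ (4 * 2 ^ d₀) (2 * d₀) ≤ R.u3.κ ∧
        (∀ K, ∀ X ∈ L.All K,
          (cells K (R.u3.C.scale X + Koff) X).Nonempty ∧ TFaceConnected (cells K (R.u3.C.scale X + Koff) X)) ∧
        (∀ K j, Set.InjOn (cells K j) ↑((L.All K).filter fun X => R.u3.C.scale X + Koff = j)) ∧
        (∀ K, ∀ X ∈ L.All K, torusTreeLen (cells K (R.u3.C.scale X + Koff) X) ≤ R.u3.C.d X) ∧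
        B14.Thm2Printed H033 fam Lb βw κ₁ ∧ βw < 1 ∧ 0 < βw ∧ 1 < Lb ∧ 1 ≤ Gv ∧ 0 ≤ Cl ∧
        (∀ K t, |t| ≤ S.l₀ → ∀ τ ∈ S.T K \ S.Bad K t, ∀ j ≤ K, ∃ (i : I) (w : (fam i).Ω) (j' : ℕ),
          (fam i).flow.SatisfiesRG (fam i).K ∧ H033 (fam i).flow (fam i).K ∧ 1 ≤ j' ∧ j' ≤ (fam i).K ∧
          (fam i).K - j' = K - j ∧ (fam i).K ≤ K + K₁ ∧
          (∀ n, 0 ≤ (fam i).gammaVol n w) ∧ (fam i).gammaVol (fam i).K w ≤ S.vol ∧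
          (∀ n, n < (fam i).K → n < jlogOf Cl (fam i).K → (fam i).gammaVol n w = 0) ∧
          (∀ n, n < (fam i).K → jlogOf Cl (fam i).K ≤ n → (fam i).gammaVol n w ≤ S.vol * Gv ^ ((fam i).K - n))) ∧
        R.ne3.g = gradConst 4 c' ∧ 0 ≤ c' ∧ R.ne3.b ≤ t ∧ c' ≤ t ∧
        (2 : ℝ) ^ 91 * (R.ne3.L : ℝ) ^ 17 * t ≤ 1 ∧ (2 : ℝ) ^ 76 * (R.ne3.L : ℝ) ^ 12 * t ≤ R.ne3.ε ∧
        16 * B7Prop2Explicit.C0 4 * R.ne3.ε ≤ 3 ∧ 1024 * (4 + 1) * (4 + 4) * (R.ne3.L : ℝ) ^ 2 * R.ne3.ε ≤ 1 ∧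
        4 * ((ℓ₃ F).ε / B F) ≤ c' ∧
        LeafH3sup 4 R.ne3.L R.ne3.Nper R.ne3.ε R.ne3.b c' R.ne3.dom ∧
        (∀ V ∈ R.ne3.dom, ∀ k : ℕ, IsMinimiser 4 (sfClass 4 R.ne3.L R.ne3.Nper R.ne3.ε) R.ne3.L R.ne3.Nper k V (sel k V)) ∧
        (∀ V ∈ R.ne3.dom, ∀ k : ℕ, RegularSup 4 R.ne3.L R.ne3.Nper R.ne3.b c' k (sel k V)) ∧
        0 < θ ∧ θ ^ 6 = ((R.ne3.L : ℝ))⁻¹ ∧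
        (∀ v ∈ Rd.dom, rd v ∈ R.ne3.dom) ∧
        (∀ k, ∀ v ∈ Rd.dom, Rd.act k v = minAct 4 (sfClass 4 R.ne3.L R.ne3.Nper R.ne3.ε) R.ne3.L R.ne3.Nper k (rd v)) ∧
        (R.ne3.Nper : ℝ) ^ 4 ≤ Rd.vol ∧
        (∀ s ∈ Window γ, 0 < bsel s ∧ bsel s ≤ γ))

include hβ1 hG16 hβw hlinkTrim

/-! ## §1 The N19′ face in the mirror's names: (B)-free, and at every slot -/

/-- ★★★ **`K3V6Defs.KeyedCoreEdgeHolderD4BFree β cr (rrOfRecord 𝔯 ksel)` BY NAME** [bookkeeping]: the sibling's ★★★ (p623655), whose conclusion IS the mirror's text (`Iff.rfl`).  ONE FACE of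
v6's stub 2 in its (B)-free shape modulo displayed hypotheses — NOT the stub, NOT K3⁸; N14 ∕ N16 ∕ N19 ∕ N22 NOT discharged. -/
theorem keyedCoreEdgeHolderD4BFree_byName_of_guardedReadingN16_letters_trimmedLinkReading (hβ23 : 2 / 3 < β)
    (hs : ∀ (F : T4Family) (θ : Stage13HParams F 2), θ.Provisos₁₃CoPH F 2 → (θ.ZhUnity F 2 ∧ θ.SlotsNondegenerate₁₃ F 2) → θ.Admissible F 2 → (ℓ F θ).Signs)
    (hL : ∀ (F : T4Family) (θ : Stage13HParams F 2), θ.Provisos₁₃CoPH F 2 → (θ.ZhUnity F 2 ∧ θ.SlotsNondegenerate₁₃ F 2) → θ.Admissible F 2 →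
      PolLimitsExistOfRecord₁₃ F 2 θ.toStage13Params)
    (h9 : ∀ (F : T4Family) (θ : Stage13HParams F 2), θ.Provisos₁₃CoPH F 2 → (θ.ZhUnity F 2 ∧ θ.SlotsNondegenerate₁₃ F 2) → θ.Admissible F 2 →
      WindowedNE9OfRecord₁₃ F 2 θ.toStage13Params (ℓ F θ).κ (ℓ F θ).moduli)
    (hWall : ∀ (μ ν : Fin 4) (F : T4Family) (θ : Stage13HParams F 2), θ.Provisos₁₃CoPH F 2 → (θ.ZhUnity F 2 ∧ θ.SlotsNondegenerate₁₃ F 2) → θ.Admissible F 2 →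
      WindowedDecayOfRecord₁₃ F 2 θ.toStage13Params μ ν (ℓ F θ).κ) :
    KeyedCoreEdgeHolderD4BFree β cr (rrOfRecord 𝔯 ksel) :=
  keyedCoreEdgeHolderD4BFree_rrOfRecord_of_guardedReadingN16_letters_trimmedLinkReading cr 𝔯 ksel ℓ ℓ₃ g B hβ1 hG16 hβw hlinkTrim hβ23 hs hL h9 hWall

/-- ★★★ **v6 STUB 2's N19′ CONJUNCT `K3V6Defs.KeyedCoreEdgeHolderD4V β cr (rrOfRecord 𝔯 ksel)` BY NAME, AT EVERY VERSION SLOT** [bookkeeping]: the mirror's transfer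
`keyedCoreEdgeHolderD4V_of_bFree` on §1.  NOT the stub (its `PinnedAtLive` witness and the other faces are untouched), NOT K3⁸; N19 NOT discharged. -/
theorem keyedCoreEdgeHolderD4V_byName_of_guardedReadingN16_letters_trimmedLinkReading (hβ23 : 2 / 3 < β)
    (hs : ∀ (F : T4Family) (θ : Stage13HParams F 2), θ.Provisos₁₃CoPH F 2 → (θ.ZhUnity F 2 ∧ θ.SlotsNondegenerate₁₃ F 2) → θ.Admissible F 2 → (ℓ F θ).Signs)
    (hL : ∀ (F : T4Family) (θ : Stage13HParams F 2), θ.Provisos₁₃CoPH F 2 → (θ.ZhUnity F 2 ∧ θ.SlotsNondegenerate₁₃ F 2) → θ.Admissible F 2 →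
      PolLimitsExistOfRecord₁₃ F 2 θ.toStage13Params)
    (h9 : ∀ (F : T4Family) (θ : Stage13HParams F 2), θ.Provisos₁₃CoPH F 2 → (θ.ZhUnity F 2 ∧ θ.SlotsNondegenerate₁₃ F 2) → θ.Admissible F 2 →
      WindowedNE9OfRecord₁₃ F 2 θ.toStage13Params (ℓ F θ).κ (ℓ F θ).moduli)
    (hWall : ∀ (μ ν : Fin 4) (F : T4Family) (θ : Stage13HParams F 2), θ.Provisos₁₃CoPH F 2 → (θ.ZhUnity F 2 ∧ θ.SlotsNondegenerate₁₃ F 2) → θ.Admissible F 2 →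
      WindowedDecayOfRecord₁₃ F 2 θ.toStage13Params μ ν (ℓ F θ).κ) :
    KeyedCoreEdgeHolderD4V β cr (rrOfRecord 𝔯 ksel) :=
  keyedCoreEdgeHolderD4V_of_bFree
    (keyedCoreEdgeHolderD4BFree_byName_of_guardedReadingN16_letters_trimmedLinkReading cr 𝔯 ksel ℓ ℓ₃ g B hβ1 hG16 hβw hlinkTrim hβ23 hs hL h9 hWall)

/-! ## §2 K3⁸ by name, conditionally, through the mirror's (B)-free door -/

/-- ★★ **K3⁸ `…Theses.BalabanUVNodes.SpineGivenEndpointR13SepCoPHV` BY NAME, CONDITIONALLY, IN THE MIRROR's NAMES** [bookkeeping]: `spineGivenEndpointR13SepCoPHV_of_facesBFree` (p625739) with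
`h19 := §1`; stub 1's rates face `hr`, stub 2's N20 ∕ N21 ∕ N27x faces `h20 h21 hx` HYPOTHESES by name.  The N19′-side bill of stmt-QuantumFields-27366: v5∕v6's key
`GuardedReadingN16`, `2∕3 < β ≤ 1`, K1⁷'s window `hβw`, def-W1's letter rows `hs hL h9` + `hWall`, NODE O's trimmed ledger reading `hlinkTrim`.  `proof.conditional`, credits nothing; NOT
a proof of K3⁸ (OPEN, unclaimed); no stub proved; counts unmoved. -/
theorem spineGivenEndpointR13SepCoPHV_of_guardedReadingN16_facesBFree_letters_trimmedLinkReading (hβ23 : 2 / 3 < β)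
    (hs : ∀ (F : T4Family) (θ : Stage13HParams F 2), θ.Provisos₁₃CoPH F 2 → (θ.ZhUnity F 2 ∧ θ.SlotsNondegenerate₁₃ F 2) → θ.Admissible F 2 → (ℓ F θ).Signs)
    (hL : ∀ (F : T4Family) (θ : Stage13HParams F 2), θ.Provisos₁₃CoPH F 2 → (θ.ZhUnity F 2 ∧ θ.SlotsNondegenerate₁₃ F 2) → θ.Admissible F 2 →
      PolLimitsExistOfRecord₁₃ F 2 θ.toStage13Params)
    (h9 : ∀ (F : T4Family) (θ : Stage13HParams F 2), θ.Provisos₁₃CoPH F 2 → (θ.ZhUnity F 2 ∧ θ.SlotsNondegenerate₁₃ F 2) → θ.Admissible F 2 →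
      WindowedNE9OfRecord₁₃ F 2 θ.toStage13Params (ℓ F θ).κ (ℓ F θ).moduli)
    (hWall : ∀ (μ ν : Fin 4) (F : T4Family) (θ : Stage13HParams F 2), θ.Provisos₁₃CoPH F 2 → (θ.ZhUnity F 2 ∧ θ.SlotsNondegenerate₁₃ F 2) → θ.Admissible F 2 →
      WindowedDecayOfRecord₁₃ F 2 θ.toStage13Params μ ν (ℓ F θ).κ)
    (hr : KeyedRatesHolderD4BFree β (rrOfRecord 𝔯 ksel)) (h20 : KeyedRelWeight cr) (h21 : KeyedShellWeight cr) (hx : KeyedExtractionBFree cr) :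
    Summit.QuantumFields.YangMills.Theses.BalabanUVNodes.SpineGivenEndpointR13SepCoPHV :=
  spineGivenEndpointR13SepCoPHV_of_facesBFree β cr (rrOfRecord 𝔯 ksel) h20 h21 hr
    (keyedCoreEdgeHolderD4BFree_byName_of_guardedReadingN16_letters_trimmedLinkReading cr 𝔯 ksel ℓ ℓ₃ g B hβ1 hG16 hβw hlinkTrim hβ23 hs hL h9 hWall) hx

end ByNameV6

end Summit.QuantumFields.YangMills.BalabanUVNodes.N19KeyedCoreEdgeHolderD4K3V6
end
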